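import Literature.NumberTheory.LFunctions.StarkNoQuadraticSubfieldProofs
import HarnessLib

/-!
# Stark 1974, Theorem 3 for a Galois number field: a real zero near `1` comes from a quadratic subfield

Topic `Literature/NumberTheory/LFunctions`, namespace
`Literature.NumberTheory.LFunctions.NumberField`. Everything in this file is PROVED (theorems only:
no definition, no named fact, no `sorry`).

> **Stark, Invent. Math. 23 (1974), Theorem 3 (p. 148).** "Let `k` be normal over `ℚ` … Suppose
> `ζ_k(s)` has a simple real zero `β`. Then there is a quadratic field `K ⊆ k` such that
> `ζ_K(β) = 0`."  Combined with **Lemma 3** (ibid.): in Stark's box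
> `1 − 1/(4 log|d_k|) ≤ σ < 1` every zero of `ζ_k` is simple (indeed `ζ_k` has at most one zero
> there), so every real zero of `ζ_k` in that interval is a zero of `ζ_K` for a quadratic
> subfield `K`.  Cf. [MurtyMurty1997, Ch. 2 §6, Prop. 6.1 and Cor. 6.2].

The tree proves the abstract Heilbronn–Stark statement
(`Heilbronn.exists_index_two_of_dedekindZetaCont_eq_zero`, `HeilbronnStark.lean`) and from it the
corollary for fields WITHOUT quadratic subfield
(`Stark1974_dedekindZeta_ne_zero_of_noQuadraticSubfield_holds`). This file records the positive
form for a GALOIS number field `F ≠ ℚ`: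

* `exists_quadratic_dedekindZetaCont_eq_zero_of_isGalois` — if `1 − 1/(4 log|d_F|) ≤ σ < 1` and
  `ζ_F(σ) = 0`, then `ζ_k(σ) = 0` for some subfield `k ⊆ F` with `[k : ℚ] = 2`;
* `dedekindZetaCont_ne_zero_of_isGalois_of_quadratic` — contrapositive: if no quadratic subfield
  of `F` has `ζ_k(σ) = 0`, then `ζ_F(σ) ≠ 0`.

Proof: the glue of `StarkNoQuadraticSubfieldGlue.lean` with `N₀ = f(F) ⊆ ℚ̄` (normal, as `F` is),
`q : Γ_ℚ → Gal(N₀/ℚ)`; `|d_{N₀}| = |d_F|`, so `σ` lies in Stark's box for `N₀` and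
`ord_σ ζ_{N₀} ≤ 1` (`meromorphicOrderAt_dedekindZetaCont_le_one`); `ζ(σ) < 0`; Heilbronn's
character is then a character `χ₁ ≠ 1` of order `2` with `ζ_{F_{H'}}(σ) = 0 ↔ H' ≤ ker χ₁`
(`dedekindZetaCont_quotientFixedField_eq_zero_iff`), and the fixed field of `ker χ₁` is a
quadratic subfield of `N₀ ≅ F` at which `ζ` vanishes; transport it back along `f`.

Used by `Summits/QuantumAdvantage/…/ThirdFactorialPincerSexticEscapeCount*.lean` (the zero-free
interval of the abelian sextic fields `K_p(ω)` reduces to that of their quadratic subfield).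

## References

* H. M. Stark, *Some effective cases of the Brauer–Siegel theorem*, Invent. Math. 23 (1974)
  135–152, Lemma 3, Theorem 3. [Stark1974]
* M. R. Murty, V. K. Murty, *Non-vanishing of `L`-functions and applications*, Birkhäuser 1997,
  Ch. 2 §6, Prop. 6.1, Cor. 6.2. [MurtyMurty1997]
-/

noncomputable section

open scoped NumberField ComplexConjugate ComplexOrder
open Complex NumberField IntermediateField
open Literature.NumberTheory.Automorphic Literature.NumberTheory.LFunctions.Heilbronn

attribute [local instance 1001] AlgebraicClosure.instAlgebra IntermediateField.algebra'
  IntermediateField.module'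

namespace Literature.NumberTheory.LFunctions.NumberField

/-- `σ > 1/2` on Stark's interval `[1 − 1/(4 log|d|), 1)` when `|d| ≥ 3`. [folklore] -/
theorem half_lt_of_one_sub_inv_four_log_le {d : ℕ} {σ : ℝ} (hd : 3 ≤ d)
    (hσ : 1 - 1 / (4 * Real.log (d : ℝ)) ≤ σ) : 1 / 2 < σ := by
  have hd' : (3 : ℝ) ≤ d := by exact_mod_cast hd
  have hlog : 1 < Real.log (d : ℝ) := by
    rw [← Real.log_exp 1]
    refine Real.log_lt_log (Real.exp_pos 1) (lt_of_lt_of_le ?_ hd')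
    have := Real.exp_one_lt_d9
    linarith
  have h4 : 1 / (4 * Real.log (d : ℝ)) < 1 / 4 := by
    rw [one_div_lt_one_div (by positivity) (by norm_num)]
    linarith
  linarith

/-- **Stark 1974, Theorem 3 (with Lemma 3), for a Galois number field.** Let `F/ℚ` be a Galois
number field, `F ≠ ℚ`, and `σ` real with `1 − 1/(4 log|d_F|) ≤ σ < 1`. If `ζ_F(σ) = 0` then
`ζ_k(σ) = 0` for some quadratic subfield `k ⊆ F`.
[cite: Stark1974, Thm. 3] [cite: MurtyMurty1997, Ch. 2 Cor. 6.2] -/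
theorem exists_quadratic_dedekindZetaCont_eq_zero_of_isGalois (F : Type) [Field F] [NumberField F]
    [IsGalois ℚ F] (hF : 1 < Module.finrank ℚ F) {σ : ℝ}
    (hσ : 1 - 1 / (4 * Real.log ((discr F).natAbs : ℝ)) ≤ σ) (hσ1 : σ < 1)
    (h0 : dedekindZetaCont F σ = 0) :
    ∃ k : IntermediateField ℚ F, Module.finrank ℚ k = 2 ∧ dedekindZetaCont k σ = 0 := by
  classical
  have hdF : 3 ≤ (discr F).natAbs := three_le_natAbs_discr F hF
  have hσ0 : 0 < σ := by have := half_lt_of_one_sub_inv_four_log_le hdF hσ; linarith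
  have hs1 : (σ : ℂ) ≠ 1 := fun h => hσ1.ne (by exact_mod_cast h)
  have hreal : conj (σ : ℂ) = σ := Complex.conj_ofReal σ
  -- an embedded copy `N₀ = f(F)` of `F` inside `ℚ̄`; it is normal over `ℚ`
  let L := AlgebraicClosure ℚ
  let f : F →ₐ[ℚ] L := IsAlgClosed.lift
  let N₀ : IntermediateField ℚ L := f.fieldRange
  have eK : F ≃ₐ[ℚ] N₀ :=
    (IntermediateField.topEquiv.symm.trans ((⊤ : IntermediateField ℚ F).equivMap f)).trans
      (IntermediateField.equivOfEq (AlgHom.fieldRange_eq_map f).symm)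
  haveI : Normal ℚ N₀ := Normal.of_algEquiv eK
  haveI : FiniteDimensional ℚ N₀ := LinearEquiv.finiteDimensional eK.toLinearEquiv
  obtain ⟨q, hq⟩ : ∃ q : Field.absoluteGaloisGroup ℚ →* (N₀ ≃ₐ[ℚ] N₀),
      q = AlgEquiv.restrictNormalHom N₀ := ⟨_, rfl⟩
  have hqA : IsArtinQuotient q := isArtinQuotient_of_eq_restrictNormalHom hq
  haveI hNF : ∀ H', NumberField (quotientFixedField q H') :=
    fun H' => numberField_quotientFixedField hqA H'
  set H : Subgroup (N₀ ≃ₐ[ℚ] N₀) := (N₀.fixingSubgroup).map q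
  have hHE : quotientFixedField q H = N₀ := quotientFixedField_map_fixingSubgroup hq le_rfl
  have hbot : quotientFixedField q ⊥ = N₀ := quotientFixedField_bot_of_eq_restrictNormalHom hq
  have htop' : quotientFixedField q ⊤ = ⊥ := quotientFixedField_top_eq_bot (q := q)
  haveI : NumberField N₀ := NumberField.of_module_finite ℚ N₀
  have hN1 : 1 < @Module.finrank ℚ N₀ _ _ DivisionRing.toRatAlgebra.toModule := by
    have h := eK.toLinearEquiv.finrank_eq
    rw [finrank_rat_eq_finrank_rat _ DivisionRing.toRatAlgebra.toModule] at h
    omega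
  -- `|d_{N₀}| = |d_F|`, so `σ` lies in Stark's box for `N₀`
  have hdisc : (discr N₀).natAbs = (discr F).natAbs :=
    congrArg Int.natAbs (NumberField.discr_eq_discr_of_algEquiv _ eK).symm
  have hσN : 1 - 1 / (4 * Real.log ((discr N₀).natAbs : ℝ)) ≤ σ := by rw [hdisc]; exact hσ
  have hbox : (σ : ℂ) ∈ starkBox ((discr N₀).natAbs : ℝ) :=
    ofReal_mem_starkBox (by rw [hdisc]; exact_mod_cast (show 1 ≤ (discr F).natAbs by omega)) hσN
  -- `ord_σ ζ_{N₀} ≤ 1` (Stark's Lemma 3), as `n(G, r_G) ≤ 1`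
  have e3 : quotientFixedField q (⊥ : Subgroup (N₀ ≃ₐ[ℚ] N₀)) ≃+* N₀ :=
    (IntermediateField.equivOfEq hbot).toRingEquiv
  have hle :
      artinOrder (σ : ℂ) ((Representation.leftRegular ℂ (N₀ ≃ₐ[ℚ] N₀)).character ∘ q) ≤ 1 := by
    have h1 := artinOrder_leftRegular hqA (σ : ℂ)
    rw [meromorphicOrderAt_dedekindZetaCont_eq_of_ringEquiv e3 hs1] at h1
    have h3 := meromorphicOrderAt_dedekindZetaCont_le_one N₀ hN1 hs1 hbox
    rw [← h1] at h3
    exact_mod_cast h3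
  -- `ζ_ℚ(σ) = ζ(σ) < 0`
  have e2 : quotientFixedField q (⊤ : Subgroup (N₀ ≃ₐ[ℚ] N₀)) ≃+* ℚ :=
    ((IntermediateField.equivOfEq htop').trans (IntermediateField.botEquiv ℚ L)).toRingEquiv
  have htop : dedekindZetaCont (quotientFixedField q (⊤ : Subgroup (N₀ ≃ₐ[ℚ] N₀))) σ ≠ 0 := by
    rw [dedekindZetaCont_eq_of_ringEquiv e2 hs1, dedekindZetaCont_rat_eq_riemannZeta_holds hs1]
    exact (riemannZeta_neg_of_pos_of_lt_one hσ0 hσ1).ne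
  -- `ζ_{F_H}(σ) = ζ_F(σ) = 0`
  have e1 : quotientFixedField q H ≃+* F :=
    ((IntermediateField.equivOfEq hHE).trans eK.symm).toRingEquiv
  have hH0 : dedekindZetaCont (quotientFixedField q H) σ = 0 := by
    rw [dedekindZetaCont_eq_of_ringEquiv e1 hs1]
    exact h0
  -- Heilbronn's character is a quadratic character `χ₁ ≠ 1`; `ζ` vanishes at the fixed field of `ker χ₁`
  rcases heilbronnChar_eq_zero_or_eq_coe hqA hs1 hreal hle with hθ | ⟨χ₁, hθ, hpm⟩
  · exact absurd hH0 (dedekindZetaCont_quotientFixedField_ne_zero_of_eq_zero hqA hs1 hθ H)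
  · have hHle : H ≤ χ₁.ker := (dedekindZetaCont_quotientFixedField_eq_zero_iff hqA hs1 hθ H).mp hH0
    have hne : χ₁ ≠ 1 := by
      intro h1
      apply htop
      rw [dedekindZetaCont_quotientFixedField_eq_zero_iff hqA hs1 hθ ⊤, h1, MonoidHom.ker_one]
    have hidx : χ₁.ker.index = 2 := index_ker_eq_two_of_sign hpm hne
    have hk0 : dedekindZetaCont (quotientFixedField q χ₁.ker) σ = 0 :=
      (dedekindZetaCont_quotientFixedField_eq_zero_iff hqA hs1 hθ χ₁.ker).mpr le_rfl
    have h2' : Module.finrank ℚ (quotientFixedField q χ₁.ker) = 2 :=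
      (finrank_quotientFixedField hqA χ₁.ker).trans hidx
    have hle2 : quotientFixedField q χ₁.ker ≤ f.fieldRange :=
      (quotientFixedField_antitone (q := q) hHle).trans_eq hHE
    -- transport the quadratic field back to `F` along `f`
    set E : IntermediateField ℚ L := quotientFixedField q χ₁.ker with hEdef
    have hmap : (E.comap f).map f = E := by
      apply le_antisymm ((IntermediateField.gc_map_comap f).l_u_le E)
      intro x hx
      obtain ⟨y, rfl⟩ := hle2 hx
      exact ⟨y, hx, rfl⟩
    have e4 : (E.comap f) ≃ₐ[ℚ] E :=
      ((E.comap f).equivMap f).trans (IntermediateField.equivOfEq hmap)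
    refine ⟨E.comap f, ?_, ?_⟩
    · have h := e4.toLinearEquiv.finrank_eq
      rw [h]
      convert h2' using 2
    · rw [dedekindZetaCont_eq_of_algEquiv e4 hs1]
      convert hk0 using 2

/-- **Contrapositive form**: for a Galois number field `F ≠ ℚ` and `1 − 1/(4 log|d_F|) ≤ σ < 1`,
if `ζ_k(σ) ≠ 0` for every quadratic subfield `k ⊆ F`, then `ζ_F(σ) ≠ 0`.
[cite: Stark1974, Thm. 3] -/
theorem dedekindZetaCont_ne_zero_of_isGalois_of_quadratic (F : Type) [Field F] [NumberField F]
    [IsGalois ℚ F] (hF : 1 < Module.finrank ℚ F) {σ : ℝ}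
    (hσ : 1 - 1 / (4 * Real.log ((discr F).natAbs : ℝ)) ≤ σ) (hσ1 : σ < 1)
    (hk : ∀ k : IntermediateField ℚ F, Module.finrank ℚ k = 2 → dedekindZetaCont k σ ≠ 0) :
    dedekindZetaCont F σ ≠ 0 := by
  intro h0
  obtain ⟨k, hk2, hk0⟩ := exists_quadratic_dedekindZetaCont_eq_zero_of_isGalois F hF hσ hσ1 h0
  exact hk k hk2 hk0

end Literature.NumberTheory.LFunctions.NumberField

end
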